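import Summits.HodgeConjecture.HodgeConjecture.Theses.HeckePrymWeil
import Summits.HodgeConjecture.HodgeConjecture.Theorems.HeckePrymWeilWeilDescendingUpward
import Summits.HodgeConjecture.HodgeConjecture.Theorems.HeckePrymWeilAssembly
import Literature.AlgebraicGeometry.Motives.AbelianVarietyProductDimProofs

/-!
# `AimedDescending` (stmt-HodgeConjecture-14643) · reductions in the route's typing

Route `HeckePrymWeil`, support item `AimedDescending` (the LEVER): for a prime `p ≡ 3 (4)`, `p ≥ 7`
and `n ≥ 1`, the SPLIT rung predicate in dimension `2n + 2` — Hodge–Weil classes are algebraic on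
every `ℚ(√-p)`-Weil abelian `(2n+2)`-fold `(A', φ')` which is of hyperbolic Weil type for the
`K`-symmetrised hyperplane class `h(e, a) = p·ι^*a + φ'^*ι^*a` of some projective embedding
`e : A'.X ⟶ ℙᴺ` and some rational `a ≠ 0` — implies the rung predicate `HWA(p, n)` in dimension
`2n` for ALL discriminants (Schoen 1998 §10; Koike 2004 Thm 2.1; Markman, arXiv:2509.23403 §11.5
Step 2, printed for `6 → 4`; van Geemen 1994, 5.2–5.4; Landherr 1936).

The printed proof has exactly two geometric inputs, and this file PROVES that they suffice, as a
sorry-free composition on the tree's real carriers (`Motives.AbelianVariety ℂ`, `complexBetti`,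
`IsHyperbolicWeilType`, `algebraicClasses`):

* **(P) the aimed partner** — for `(A, φ)` of dimension `2n` carrying a NON-ZERO rational `(n, n)`
  Weil class (so `(A, φ)` is of Weil type `(n, n)`), there is a Weil SURFACE `(B, ψ)` (`dim B = 2`,
  `ψ ≫ ψ = -p`, a non-zero rational `(1,1)`-class in its Weil plane) such that the product
  `(A × B, φ × ψ)` is of hyperbolic Weil type for the `K`-symmetrised hyperplane class of SOME
  projective embedding of `A × B` and some rational `a ≠ 0` (in print: `B = E₀ × E₀`, `E₀ = ℂ/O_K`,
  `K` acting by `(ι, ῑ)`, polarisation weights `(m₁, m₂)` with `-m₁ m₂ ≡ (-1)ⁿ⁺¹ det H_A` in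
  `ℚ^×/Nm(K^×)`, which is 2-torsion; Landherr: signature `(n+1, n+1)` and discriminant `(-1)ⁿ⁺¹`
  means hyperbolic);
* **(D) the pointwise product descent** — for `(A, φ)` of dimension `2n` and ANY Weil surface
  `(B, ψ)` with a non-zero rational `(1,1)` Weil class: if the rational `(n+1, n+1)` Weil classes
  of `(A × B, φ × ψ)` are algebraic, so are the rational `(n, n)` Weil classes of `(A, φ)` (Schoen's
  transfer `pr_{A*}(u ∪ pr_B^* η)`; the pointwise form of the route's `ProductDescent`).

Main results:

* `aimedDescending_of_partner_of_descent` — **(P) ∧ (D) ⟹ `AimedDescending`** (glue proved here: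
  the case `c = 0`; `dim (A × B) = 2(n+1)` by the tree's `AbelianVariety.dim_prod`;
  `(φ × ψ)² = -p` by the landed `prodLift_comp_self_eq_neg_zsmul`
  (`Theorems/HeckePrymWeilWeilDescendingUpward`); the split rung hypothesis is instantiated at the
  aimed product and (D) descends).
* `weilDescending_of_aimedDescending` — the lever is STRONGER than the sibling support
  `WeilDescending` (stmt-1263): `HWA(p, n+1)` trivially implies its split half (pure logic).
* `productDescent_of_descent` — (D) implies the route's `ProductDescent` (stmt-14498) (pure logic);
  `weilDescending_of_descent_of_surface` — (D) and ONE Weil surface per `p` imply `WeilDescending`.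
* `aimedDescending_of_ladder_of_weilDescending` — conversely the route's target `HodgeWeilLadder`
  with `WeilDescending` implies the lever (its conclusion is `HWA(p, n)`; the landed ℕ-arithmetic
  `heckePrymWeil_ladder_descent` of `Theorems/HeckePrymWeilAssembly`).

How the lever is consumed — `HyperbolicEightfoldsSqrtMinus7 → AimedDescending →
WeilSixfoldsSqrtMinus7` — is the landed `weilSixfoldsSqrtMinus7_of_hyperbolicEightfolds_of_aimedDescending`
(`Theorems/HeckePrymWeilEightfoldDescentGlue`, item `EightfoldDescentGlue`), not repeated here.

What is NOT here (census of the item): (P) needs a CM Weil surface `E₀ × E₀` with its `K`-action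
as an `AbelianVariety ℂ` endomorphism, Künneth for `H¹` of a product, and the dictionary
`Q_h ∝ E^*` of `Motives/HyperbolicWeilType` (3); (D) needs Künneth, Hodge types of exterior
products and the Gysin transfer along `complexGysin` — the infrastructure named in the item text.
-/

noncomputable section

-- every declaration of this problem lives in `Summit.HodgeConjecture.HodgeConjecture.…`
set_option linter.dupNamespace false

open CategoryTheory
open Literature.AlgebraicGeometry Literature.AlgebraicGeometry.HodgeTheory
open Summit.HodgeConjecture.HodgeConjecture.Theses.HeckePrymWeil

namespace Summit.HodgeConjecture.HodgeConjecture.Theorems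

/-- **One rung, pointwise in `(p, n)`: split rung in dimension `2(n+1)` ∧ (P) ∧ (D) ⟹ rung in
dimension `2n`.** Given the split rung predicate in dimension `2(n+1)`, an abelian `2n`-fold
`(A, φ)` with `φ ≫ φ = -p` and a rational `(n, n)` Weil class `c`: if `c = 0` it is algebraic;
otherwise `c` witnesses Weil type, (P) supplies a Weil surface `(B, ψ)` with a non-zero rational
`(1,1)` Weil class, a projective embedding `e` of `A × B` and a rational `a ≠ 0` making
`(A × B, φ × ψ, h(e, a))` hyperbolic; `A × B` has dimension `2(n+1)` (`dim_prod`) and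
`(φ × ψ)² = -p`, so the split rung hypothesis makes every rational `(n+1, n+1)` Weil class of
`(A × B, φ × ψ)` algebraic, and (D) returns `c` algebraic (Schoen 1998 §10; Markman
arXiv:2509.23403 §11.5 Step 2; Koike 2004 Thm 2.1). No hypothesis on `p`, `n` is needed for the
glue. -/
theorem rung_of_splitRung_of_partner_of_descent {p n : ℕ}
    (hP : ∀ (A : Motives.AbelianVariety ℂ) (φ : A ⟶ A), A.dim = 2 * n → φ ≫ φ = -((p : ℤ) • 𝟙 A) →
      (∃ c : complexBetti A.X (2 * n), c ≠ 0 ∧ IsRationalClass c ∧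
        IsOfHodgeType (2 * n) A.X (2 * n) n n c ∧
        c ∈ Module.End.eigenspace (complexBetti.map (𝟙 A + φ).hom.hom.hom (2 * n)).hom
              ((1 + Complex.I * (Real.sqrt (p : ℝ) : ℂ)) ^ (2 * n)) ⊔
            Module.End.eigenspace (complexBetti.map (𝟙 A + φ).hom.hom.hom (2 * n)).hom
              ((1 - Complex.I * (Real.sqrt (p : ℝ) : ℂ)) ^ (2 * n))) →
      ∃ (B : Motives.AbelianVariety ℂ) (ψ : B ⟶ B), B.dim = 2 ∧ ψ ≫ ψ = -((p : ℤ) • 𝟙 B) ∧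
        (∃ b : complexBetti B.X (2 * 1), b ≠ 0 ∧ IsRationalClass b ∧
          IsOfHodgeType (2 * 1) B.X (2 * 1) 1 1 b ∧
          b ∈ Module.End.eigenspace (complexBetti.map (𝟙 B + ψ).hom.hom.hom (2 * 1)).hom
                ((1 + Complex.I * (Real.sqrt (p : ℝ) : ℂ)) ^ (2 * 1)) ⊔
              Module.End.eigenspace (complexBetti.map (𝟙 B + ψ).hom.hom.hom (2 * 1)).hom
                ((1 - Complex.I * (Real.sqrt (p : ℝ) : ℂ)) ^ (2 * 1))) ∧
        ∃ (e : Motives.ProjectiveEmbedding (A.prod B).X)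
          (a : complexBetti (Motives.projectiveSpace e.n ℂ) 2), IsRationalClass a ∧ a ≠ 0 ∧
          Motives.IsHyperbolicWeilType (A.prod B)
            (Motives.AbelianVariety.prodLift (Motives.AbelianVariety.fst A B ≫ φ)
              (Motives.AbelianVariety.snd A B ≫ ψ)) (n + 1)
            ((p : ℂ) • complexBetti.map e.ι 2 a +
              complexBetti.map (Motives.AbelianVariety.prodLift (Motives.AbelianVariety.fst A B ≫ φ)
                (Motives.AbelianVariety.snd A B ≫ ψ)).hom.hom.hom 2 (complexBetti.map e.ι 2 a)))
    (hD : ∀ (A : Motives.AbelianVariety ℂ) (φ : A ⟶ A) (B : Motives.AbelianVariety ℂ) (ψ : B ⟶ B),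
      A.dim = 2 * n → B.dim = 2 → φ ≫ φ = -((p : ℤ) • 𝟙 A) → ψ ≫ ψ = -((p : ℤ) • 𝟙 B) →
      (∃ b : complexBetti B.X (2 * 1), b ≠ 0 ∧ IsRationalClass b ∧
        IsOfHodgeType (2 * 1) B.X (2 * 1) 1 1 b ∧
        b ∈ Module.End.eigenspace (complexBetti.map (𝟙 B + ψ).hom.hom.hom (2 * 1)).hom
              ((1 + Complex.I * (Real.sqrt (p : ℝ) : ℂ)) ^ (2 * 1)) ⊔
            Module.End.eigenspace (complexBetti.map (𝟙 B + ψ).hom.hom.hom (2 * 1)).hom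
              ((1 - Complex.I * (Real.sqrt (p : ℝ) : ℂ)) ^ (2 * 1))) →
      (∀ u : complexBetti (A.prod B).X (2 * (n + 1)), IsRationalClass u →
        IsOfHodgeType (2 * (n + 1)) (A.prod B).X (2 * (n + 1)) (n + 1) (n + 1) u →
        u ∈ Module.End.eigenspace (complexBetti.map (𝟙 (A.prod B) +
                Motives.AbelianVariety.prodLift (Motives.AbelianVariety.fst A B ≫ φ)
                  (Motives.AbelianVariety.snd A B ≫ ψ)).hom.hom.hom (2 * (n + 1))).hom
              ((1 + Complex.I * (Real.sqrt (p : ℝ) : ℂ)) ^ (2 * (n + 1))) ⊔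
            Module.End.eigenspace (complexBetti.map (𝟙 (A.prod B) +
                Motives.AbelianVariety.prodLift (Motives.AbelianVariety.fst A B ≫ φ)
                  (Motives.AbelianVariety.snd A B ≫ ψ)).hom.hom.hom (2 * (n + 1))).hom
              ((1 - Complex.I * (Real.sqrt (p : ℝ) : ℂ)) ^ (2 * (n + 1))) →
        u ∈ algebraicClasses (A.prod B).X (n + 1)) →
      ∀ c : complexBetti A.X (2 * n), IsRationalClass c → IsOfHodgeType (2 * n) A.X (2 * n) n n c →
        c ∈ Module.End.eigenspace (complexBetti.map (𝟙 A + φ).hom.hom.hom (2 * n)).hom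
              ((1 + Complex.I * (Real.sqrt (p : ℝ) : ℂ)) ^ (2 * n)) ⊔
            Module.End.eigenspace (complexBetti.map (𝟙 A + φ).hom.hom.hom (2 * n)).hom
              ((1 - Complex.I * (Real.sqrt (p : ℝ) : ℂ)) ^ (2 * n)) →
        c ∈ algebraicClasses A.X n)
    (hSplit : ∀ (A : Motives.AbelianVariety ℂ) (φ : A ⟶ A), A.dim = 2 * (n + 1) →
      φ ≫ φ = -((p : ℤ) • 𝟙 A) →
      ∀ (e : Motives.ProjectiveEmbedding A.X) (a : complexBetti (Motives.projectiveSpace e.n ℂ) 2),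
        IsRationalClass a → a ≠ 0 →
        Motives.IsHyperbolicWeilType A φ (n + 1)
          ((p : ℂ) • complexBetti.map e.ι 2 a + complexBetti.map φ.hom.hom.hom 2 (complexBetti.map e.ι 2 a)) →
      ∀ c : complexBetti A.X (2 * (n + 1)), IsRationalClass c →
        IsOfHodgeType (2 * (n + 1)) A.X (2 * (n + 1)) (n + 1) (n + 1) c →
        c ∈ Module.End.eigenspace (complexBetti.map (𝟙 A + φ).hom.hom.hom (2 * (n + 1))).hom
              ((1 + Complex.I * (Real.sqrt (p : ℝ) : ℂ)) ^ (2 * (n + 1))) ⊔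
            Module.End.eigenspace (complexBetti.map (𝟙 A + φ).hom.hom.hom (2 * (n + 1))).hom
              ((1 - Complex.I * (Real.sqrt (p : ℝ) : ℂ)) ^ (2 * (n + 1))) →
        c ∈ algebraicClasses A.X (n + 1)) :
    ∀ (A : Motives.AbelianVariety ℂ) (φ : A ⟶ A), A.dim = 2 * n → φ ≫ φ = -((p : ℤ) • 𝟙 A) →
      ∀ c : complexBetti A.X (2 * n), IsRationalClass c → IsOfHodgeType (2 * n) A.X (2 * n) n n c →
        c ∈ Module.End.eigenspace (complexBetti.map (𝟙 A + φ).hom.hom.hom (2 * n)).hom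
              ((1 + Complex.I * (Real.sqrt (p : ℝ) : ℂ)) ^ (2 * n)) ⊔
            Module.End.eigenspace (complexBetti.map (𝟙 A + φ).hom.hom.hom (2 * n)).hom
              ((1 - Complex.I * (Real.sqrt (p : ℝ) : ℂ)) ^ (2 * n)) →
        c ∈ algebraicClasses A.X n := by
  intro A φ hA hφ c hrat hH hW
  by_cases hc : c = 0
  · rw [hc]
    exact Submodule.zero_mem _
  obtain ⟨B, ψ, hB, hψ, hb, e, a, ha, ha0, hhyp⟩ := hP A φ hA hφ ⟨c, hc, hrat, hH, hW⟩
  have hdim : (A.prod B).dim = 2 * (n + 1) := by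
    rw [Motives.AbelianVariety.dim_prod, hA, hB]
    ring
  exact hD A φ B ψ hA hB hφ hψ hb
    (hSplit (A.prod B) _ hdim (prodLift_comp_self_eq_neg_zsmul hφ hψ) e a ha ha0 hhyp)
    c hrat hH hW

/-- **The lever from its two printed inputs: (P) aimed partner ∧ (D) pointwise product descent
⟹ `AimedDescending`** (both inputs for all primes `p ≡ 3 (4)`, `p ≥ 7` and all `n ≥ 1`;
`rung_of_splitRung_of_partner_of_descent` rung by rung). (P) is Schoen 1998 §10 / Markman
arXiv:2509.23403 §11.5 Step 2 with the partner AIMED by Landherr's theorem (van Geemen 1994, 5.2–5.4: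
`ℚ^×/Nm(K^×)` is 2-torsion, `det H` multiplicative); (D) is Schoen's transfer. -/
theorem aimedDescending_of_partner_of_descent
    (hP : ∀ p : ℕ, p.Prime → p % 4 = 3 → 7 ≤ p → ∀ n : ℕ, 1 ≤ n →
      ∀ (A : Motives.AbelianVariety ℂ) (φ : A ⟶ A), A.dim = 2 * n → φ ≫ φ = -((p : ℤ) • 𝟙 A) →
      (∃ c : complexBetti A.X (2 * n), c ≠ 0 ∧ IsRationalClass c ∧
        IsOfHodgeType (2 * n) A.X (2 * n) n n c ∧
        c ∈ Module.End.eigenspace (complexBetti.map (𝟙 A + φ).hom.hom.hom (2 * n)).hom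
              ((1 + Complex.I * (Real.sqrt (p : ℝ) : ℂ)) ^ (2 * n)) ⊔
            Module.End.eigenspace (complexBetti.map (𝟙 A + φ).hom.hom.hom (2 * n)).hom
              ((1 - Complex.I * (Real.sqrt (p : ℝ) : ℂ)) ^ (2 * n))) →
      ∃ (B : Motives.AbelianVariety ℂ) (ψ : B ⟶ B), B.dim = 2 ∧ ψ ≫ ψ = -((p : ℤ) • 𝟙 B) ∧
        (∃ b : complexBetti B.X (2 * 1), b ≠ 0 ∧ IsRationalClass b ∧
          IsOfHodgeType (2 * 1) B.X (2 * 1) 1 1 b ∧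
          b ∈ Module.End.eigenspace (complexBetti.map (𝟙 B + ψ).hom.hom.hom (2 * 1)).hom
                ((1 + Complex.I * (Real.sqrt (p : ℝ) : ℂ)) ^ (2 * 1)) ⊔
              Module.End.eigenspace (complexBetti.map (𝟙 B + ψ).hom.hom.hom (2 * 1)).hom
                ((1 - Complex.I * (Real.sqrt (p : ℝ) : ℂ)) ^ (2 * 1))) ∧
        ∃ (e : Motives.ProjectiveEmbedding (A.prod B).X)
          (a : complexBetti (Motives.projectiveSpace e.n ℂ) 2), IsRationalClass a ∧ a ≠ 0 ∧
          Motives.IsHyperbolicWeilType (A.prod B)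
            (Motives.AbelianVariety.prodLift (Motives.AbelianVariety.fst A B ≫ φ)
              (Motives.AbelianVariety.snd A B ≫ ψ)) (n + 1)
            ((p : ℂ) • complexBetti.map e.ι 2 a +
              complexBetti.map (Motives.AbelianVariety.prodLift (Motives.AbelianVariety.fst A B ≫ φ)
                (Motives.AbelianVariety.snd A B ≫ ψ)).hom.hom.hom 2 (complexBetti.map e.ι 2 a)))
    (hD : ∀ p : ℕ, p.Prime → p % 4 = 3 → 7 ≤ p → ∀ n : ℕ, 1 ≤ n →
      ∀ (A : Motives.AbelianVariety ℂ) (φ : A ⟶ A) (B : Motives.AbelianVariety ℂ) (ψ : B ⟶ B),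
      A.dim = 2 * n → B.dim = 2 → φ ≫ φ = -((p : ℤ) • 𝟙 A) → ψ ≫ ψ = -((p : ℤ) • 𝟙 B) →
      (∃ b : complexBetti B.X (2 * 1), b ≠ 0 ∧ IsRationalClass b ∧
        IsOfHodgeType (2 * 1) B.X (2 * 1) 1 1 b ∧
        b ∈ Module.End.eigenspace (complexBetti.map (𝟙 B + ψ).hom.hom.hom (2 * 1)).hom
              ((1 + Complex.I * (Real.sqrt (p : ℝ) : ℂ)) ^ (2 * 1)) ⊔
            Module.End.eigenspace (complexBetti.map (𝟙 B + ψ).hom.hom.hom (2 * 1)).hom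
              ((1 - Complex.I * (Real.sqrt (p : ℝ) : ℂ)) ^ (2 * 1))) →
      (∀ u : complexBetti (A.prod B).X (2 * (n + 1)), IsRationalClass u →
        IsOfHodgeType (2 * (n + 1)) (A.prod B).X (2 * (n + 1)) (n + 1) (n + 1) u →
        u ∈ Module.End.eigenspace (complexBetti.map (𝟙 (A.prod B) +
                Motives.AbelianVariety.prodLift (Motives.AbelianVariety.fst A B ≫ φ)
                  (Motives.AbelianVariety.snd A B ≫ ψ)).hom.hom.hom (2 * (n + 1))).hom
              ((1 + Complex.I * (Real.sqrt (p : ℝ) : ℂ)) ^ (2 * (n + 1))) ⊔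
            Module.End.eigenspace (complexBetti.map (𝟙 (A.prod B) +
                Motives.AbelianVariety.prodLift (Motives.AbelianVariety.fst A B ≫ φ)
                  (Motives.AbelianVariety.snd A B ≫ ψ)).hom.hom.hom (2 * (n + 1))).hom
              ((1 - Complex.I * (Real.sqrt (p : ℝ) : ℂ)) ^ (2 * (n + 1))) →
        u ∈ algebraicClasses (A.prod B).X (n + 1)) →
      ∀ c : complexBetti A.X (2 * n), IsRationalClass c → IsOfHodgeType (2 * n) A.X (2 * n) n n c →
        c ∈ Module.End.eigenspace (complexBetti.map (𝟙 A + φ).hom.hom.hom (2 * n)).hom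
              ((1 + Complex.I * (Real.sqrt (p : ℝ) : ℂ)) ^ (2 * n)) ⊔
            Module.End.eigenspace (complexBetti.map (𝟙 A + φ).hom.hom.hom (2 * n)).hom
              ((1 - Complex.I * (Real.sqrt (p : ℝ) : ℂ)) ^ (2 * n)) →
        c ∈ algebraicClasses A.X n) :
    AimedDescending :=
  fun p hp hp4 hp7 n hn hSplit =>
    rung_of_splitRung_of_partner_of_descent (hP p hp hp4 hp7 n hn) (hD p hp hp4 hp7 n hn)
      (fun A φ hA hφ => hSplit (n + 1) rfl A φ hA hφ)

/-- **The lever is stronger than `WeilDescending`** (stmt-HodgeConjecture-1263): the full rung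
predicate `HWA(p, n+1)` implies its split half (forget the embedding, the class `a` and the
hyperbolicity), so `AimedDescending` gives `HWA(p, n+1) ⟹ HWA(p, n)`. Pure logic. -/
theorem weilDescending_of_aimedDescending (h : AimedDescending) : WeilDescending := by
  intro p hp hp4 hp7 n hn hrung
  exact h p hp hp4 hp7 n hn fun m hm A φ hA hφ _ _ _ _ _ => hrung m hm A φ hA hφ

/-- **The pointwise product descent (D) implies the route's `ProductDescent`**
(stmt-HodgeConjecture-14498, whose hypothesis supplies, for every `(A, φ)`, SOME Weil surface
partner with algebraic product Weil classes). Pure logic. -/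
theorem productDescent_of_descent
    (hD : ∀ p : ℕ, p.Prime → p % 4 = 3 → 7 ≤ p → ∀ n : ℕ, 1 ≤ n →
      ∀ (A : Motives.AbelianVariety ℂ) (φ : A ⟶ A) (B : Motives.AbelianVariety ℂ) (ψ : B ⟶ B),
      A.dim = 2 * n → B.dim = 2 → φ ≫ φ = -((p : ℤ) • 𝟙 A) → ψ ≫ ψ = -((p : ℤ) • 𝟙 B) →
      (∃ b : complexBetti B.X (2 * 1), b ≠ 0 ∧ IsRationalClass b ∧
        IsOfHodgeType (2 * 1) B.X (2 * 1) 1 1 b ∧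
        b ∈ Module.End.eigenspace (complexBetti.map (𝟙 B + ψ).hom.hom.hom (2 * 1)).hom
              ((1 + Complex.I * (Real.sqrt (p : ℝ) : ℂ)) ^ (2 * 1)) ⊔
            Module.End.eigenspace (complexBetti.map (𝟙 B + ψ).hom.hom.hom (2 * 1)).hom
              ((1 - Complex.I * (Real.sqrt (p : ℝ) : ℂ)) ^ (2 * 1))) →
      (∀ u : complexBetti (A.prod B).X (2 * (n + 1)), IsRationalClass u →
        IsOfHodgeType (2 * (n + 1)) (A.prod B).X (2 * (n + 1)) (n + 1) (n + 1) u →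
        u ∈ Module.End.eigenspace (complexBetti.map (𝟙 (A.prod B) +
                Motives.AbelianVariety.prodLift (Motives.AbelianVariety.fst A B ≫ φ)
                  (Motives.AbelianVariety.snd A B ≫ ψ)).hom.hom.hom (2 * (n + 1))).hom
              ((1 + Complex.I * (Real.sqrt (p : ℝ) : ℂ)) ^ (2 * (n + 1))) ⊔
            Module.End.eigenspace (complexBetti.map (𝟙 (A.prod B) +
                Motives.AbelianVariety.prodLift (Motives.AbelianVariety.fst A B ≫ φ)
                  (Motives.AbelianVariety.snd A B ≫ ψ)).hom.hom.hom (2 * (n + 1))).hom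
              ((1 - Complex.I * (Real.sqrt (p : ℝ) : ℂ)) ^ (2 * (n + 1))) →
        u ∈ algebraicClasses (A.prod B).X (n + 1)) →
      ∀ c : complexBetti A.X (2 * n), IsRationalClass c → IsOfHodgeType (2 * n) A.X (2 * n) n n c →
        c ∈ Module.End.eigenspace (complexBetti.map (𝟙 A + φ).hom.hom.hom (2 * n)).hom
              ((1 + Complex.I * (Real.sqrt (p : ℝ) : ℂ)) ^ (2 * n)) ⊔
            Module.End.eigenspace (complexBetti.map (𝟙 A + φ).hom.hom.hom (2 * n)).hom
              ((1 - Complex.I * (Real.sqrt (p : ℝ) : ℂ)) ^ (2 * n)) →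
        c ∈ algebraicClasses A.X n) :
    ProductDescent := by
  intro p hp hp4 hp7 n hn hpart A φ hA hφ c hrat hH hW
  obtain ⟨B, ψ, hB, hψ, hb, halg⟩ := hpart A φ hA hφ
  exact hD p hp hp4 hp7 n hn A φ B ψ hA hB hφ hψ hb halg c hrat hH hW

/-- **(D) and ONE Weil surface per `p` give `WeilDescending`** (stmt-HodgeConjecture-1263): for
`(A, φ)` of dimension `2n` and a Weil surface `(B, ψ)` with a non-zero rational `(1,1)` Weil class,
`A × B` has dimension `2(n+1)` and `(φ × ψ)² = -p`, so the full rung `HWA(p, n+1)` makes its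
rational `(n+1, n+1)` Weil classes algebraic and (D) descends. With `productDescent_of_descent`
this shows that both support hypotheses of the route's deciding theorem rest on the pointwise
descent (D) plus the existence of a single `ℚ(√-p)`-Weil surface (e.g. `E × E` with
`ψ = (0, -p; 1, 0)`, of Weil type `(1,1)` for every elliptic curve `E`; van Geemen 1994, 5.3). -/
theorem weilDescending_of_descent_of_surface
    (hD : ∀ p : ℕ, p.Prime → p % 4 = 3 → 7 ≤ p → ∀ n : ℕ, 1 ≤ n →
      ∀ (A : Motives.AbelianVariety ℂ) (φ : A ⟶ A) (B : Motives.AbelianVariety ℂ) (ψ : B ⟶ B),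
      A.dim = 2 * n → B.dim = 2 → φ ≫ φ = -((p : ℤ) • 𝟙 A) → ψ ≫ ψ = -((p : ℤ) • 𝟙 B) →
      (∃ b : complexBetti B.X (2 * 1), b ≠ 0 ∧ IsRationalClass b ∧
        IsOfHodgeType (2 * 1) B.X (2 * 1) 1 1 b ∧
        b ∈ Module.End.eigenspace (complexBetti.map (𝟙 B + ψ).hom.hom.hom (2 * 1)).hom
              ((1 + Complex.I * (Real.sqrt (p : ℝ) : ℂ)) ^ (2 * 1)) ⊔
            Module.End.eigenspace (complexBetti.map (𝟙 B + ψ).hom.hom.hom (2 * 1)).hom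
              ((1 - Complex.I * (Real.sqrt (p : ℝ) : ℂ)) ^ (2 * 1))) →
      (∀ u : complexBetti (A.prod B).X (2 * (n + 1)), IsRationalClass u →
        IsOfHodgeType (2 * (n + 1)) (A.prod B).X (2 * (n + 1)) (n + 1) (n + 1) u →
        u ∈ Module.End.eigenspace (complexBetti.map (𝟙 (A.prod B) +
                Motives.AbelianVariety.prodLift (Motives.AbelianVariety.fst A B ≫ φ)
                  (Motives.AbelianVariety.snd A B ≫ ψ)).hom.hom.hom (2 * (n + 1))).hom
              ((1 + Complex.I * (Real.sqrt (p : ℝ) : ℂ)) ^ (2 * (n + 1))) ⊔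
            Module.End.eigenspace (complexBetti.map (𝟙 (A.prod B) +
                Motives.AbelianVariety.prodLift (Motives.AbelianVariety.fst A B ≫ φ)
                  (Motives.AbelianVariety.snd A B ≫ ψ)).hom.hom.hom (2 * (n + 1))).hom
              ((1 - Complex.I * (Real.sqrt (p : ℝ) : ℂ)) ^ (2 * (n + 1))) →
        u ∈ algebraicClasses (A.prod B).X (n + 1)) →
      ∀ c : complexBetti A.X (2 * n), IsRationalClass c → IsOfHodgeType (2 * n) A.X (2 * n) n n c →
        c ∈ Module.End.eigenspace (complexBetti.map (𝟙 A + φ).hom.hom.hom (2 * n)).hom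
              ((1 + Complex.I * (Real.sqrt (p : ℝ) : ℂ)) ^ (2 * n)) ⊔
            Module.End.eigenspace (complexBetti.map (𝟙 A + φ).hom.hom.hom (2 * n)).hom
              ((1 - Complex.I * (Real.sqrt (p : ℝ) : ℂ)) ^ (2 * n)) →
        c ∈ algebraicClasses A.X n)
    (hB : ∀ p : ℕ, p.Prime → p % 4 = 3 → 7 ≤ p →
      ∃ (B : Motives.AbelianVariety ℂ) (ψ : B ⟶ B), B.dim = 2 ∧ ψ ≫ ψ = -((p : ℤ) • 𝟙 B) ∧
        ∃ b : complexBetti B.X (2 * 1), b ≠ 0 ∧ IsRationalClass b ∧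
          IsOfHodgeType (2 * 1) B.X (2 * 1) 1 1 b ∧
          b ∈ Module.End.eigenspace (complexBetti.map (𝟙 B + ψ).hom.hom.hom (2 * 1)).hom
                ((1 + Complex.I * (Real.sqrt (p : ℝ) : ℂ)) ^ (2 * 1)) ⊔
              Module.End.eigenspace (complexBetti.map (𝟙 B + ψ).hom.hom.hom (2 * 1)).hom
                ((1 - Complex.I * (Real.sqrt (p : ℝ) : ℂ)) ^ (2 * 1))) :
    WeilDescending := by
  intro p hp hp4 hp7 n hn hrung A φ hA hφ c hrat hH hW
  obtain ⟨B, ψ, hBd, hψ, hb⟩ := hB p hp hp4 hp7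
  have hdim : (A.prod B).dim = 2 * (n + 1) := by
    rw [Motives.AbelianVariety.dim_prod, hA, hBd]
    ring
  exact hD p hp hp4 hp7 n hn A φ B ψ hA hBd hφ hψ hb
    (hrung (n + 1) rfl (A.prod B) _ hdim (prodLift_comp_self_eq_neg_zsmul hφ hψ))
    c hrat hH hW

/-- **The lever adds no burden beyond the route's target**: `HodgeWeilLadder` (X) and
`WeilDescending` already give the rung predicate `HWA(p, n)` for every `n ≥ 1` (rungs at
`n = M(g-1)`, `M = (p-1)/2 ≥ 3`, then one-step descents — the `ℕ`-arithmetic of the route's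
deciding theorem `closes`), which is the conclusion of `AimedDescending` with its split hypothesis
ignored. Pure logic. -/
theorem aimedDescending_of_ladder_of_weilDescending (hL : HodgeWeilLadder) (hD : WeilDescending) :
    AimedDescending := by
  intro p hp hp4 hp7 n hn _
  exact heckePrymWeil_ladder_descent _ ((p - 1) / 2) (by omega) (hL p hp hp4 hp7) (hD p hp hp4 hp7) n hn

end Summit.HodgeConjecture.HodgeConjecture.Theorems

end
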